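import Summits.QuantumFields.BalabanUV.Beta.D1BFx.ChargeFreeComposition
import Summits.QuantumFields.BalabanUV.Beta.TameKernelCalculus

/-!
# `BalabanUV.Beta.D1BFx.ChargeFreeEnvelopes` — road «BF-x» for binder row D1, slot (K), PART 24 (R-BB ∕ R-AB supplier side): **THE COMPOSED-LEG
# ENVELOPES AFTER THE ABEL STEP** — a leg composed with a COLUMN-charge-free banded kernel on its right costs the leg's OSCILLATION over the band in its
# second variable × the kernel's column mass; a ROW-charge-free banded kernel on its left costs the oscillation in the first variable × the row mass; a leg
# sandwiched between a row-charge-free kernel (left) and a column-charge-free kernel (right) costs its MIXED second oscillation × both masses — and the three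
# oscillations come from UNIT-difference envelopes WITH the leg's decay (`β′·R·e^{θR}·e^{−θ|·|₁}`, `β″·R²·e^{2θR}·e^{−θ|·|₁}`) by telescoping inside an `ℓ¹`-ball

HONEST DEPENDENCY (cell records, verbatim): «continuum YM on T⁴ ⇐ BetaPertH ∧ nine spine estimates (0/9 proved); BetaPertH ⇐ (D1) ∧ (D4) ∧
CAP+tail; G-an2-4 gates asym, D1 and NE2/3/4.»  HONEST FRAMING (cell contract, verbatim): «discharging `BetaPertH` makes Bałaban's UV stability
UNCONDITIONAL — a real constructive-QFT result; it is NOT the continuum limit and NOT the Clay problem.»  THIS MODULE is [folklore] `ℓ¹`∕`tsum` bookkeeping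
over an2's `ExpKernelCalculus` (`MKer`, `comp`, `l1`), an5's `TameKernelCalculus` (`Tame ∕ Spr ∕ Loc`, `slice_tame`) and this lineage's `ChargeFreeComposition`
(p353203 ✓: `comp_eq_tsum_mul_sub ∕ comp_eq_tsum_sub_mul ∕ abs_comp_le_mul_tsum_of_support`); every kernel is ARBITRARY, every envelope a DISPLAYED
`∀`-hypothesis; no `def`, no `def … : Prop`, nothing cited, 0 sorry.  WHAT IT IS FOR (OWNER d1-p2 g23 `PART24-SPEC-g23.md` §1–§2 R-BB ∕ R-AB «one gain per
vertex»; this seat's W-1 [D1LEAF01-G30-W1], journal l.50333): after the dipole split of a zero-total-charge vertex table into a column-charge-free and a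
row-charge-free banded piece, the four split terms of a bubble `tr(K₁∘V∘K₂∘V′)` are traces of composed kernels whose envelopes are EXACTLY §4 below with
`G` = a leg's oscillation; the gains land on (K₁,K₂), (K₂,K₁), (K₁,K₁), (K₂,K₂) — the last two through the MIXED envelope (`β″`).  WHAT IT IS NOT: no word
is priced here (the weighted-mass assembly `ChargeFreeBubble` and the profile × count assembly of leaf-04's `ProfileWordCount ∕ …Families` are the two
consumers); NOT L-B″; NOT a (1.22) row; 0 root-level binders of row D1 discharged (hW ∕ hR-sockets ∕ hSX-socket ∕ D1Tel ∕ D1Rep = 0); (K) NOT closed; NOT D1, NOT `BetaPertH`, NOT continuum, NOT Clay.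
ABSOLUTE RULE (cell charter, verbatim): «No internally-minted statement may enter as a cited fact. Every hypothesis is either kernel-proved in
this package or a verbatim quotation of a PUBLISHED theorem with page reference. The manuscript(s) under audit are NOT citable for their own
disputed steps — they are the thing under adjudication; programme-internal (2001/route/tribunal) claims are never citable.»

CONTENT ([folklore]; `D`, `F` arbitrary; `|·|₁ = B12Sec2to5.l1`, `e_κ = AffineAveraging.unitVec κ`).
* §1 TELESCOPING INSIDE AN `ℓ¹`-BALL: `natAbs_sum_eq_l1`, `exists_unit_step` (a lattice point at `ℓ¹`-distance `k+1` from the centre is one unit step from a point at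
  distance `k`), **`abs_sub_le_mul_of_unitDiff_ball`** ∕ **`abs_sub_le_of_unitDiff_ball`** (unit differences `≤ G` on the ball of radius `ρ` about `c` ⟹
  `|f y − f c| ≤ G·|y − c|₁` on that ball — the LOCALISED twin of `ChargeFreeComposition.abs_sub_le_mul_l1Dist_of_unitDiff_le`).
* §2 LEG OSCILLATIONS FROM UNIT-DIFFERENCE ENVELOPES WITH DECAY: **`osc_snd_of_unitDiff`** (`|A x (w+e_ρ) − A x w| ≤ β′e^{−θ|x−w|₁}` ⟹ `|y−z|₁ ≤ R ⟹
  |A x y − A x z| ≤ β′·R·e^{θR}·e^{−θ|x−z|₁}`), **`osc_fst_of_unitDiff`** (first variable), **`osc_mixed_of_unitDiff`** (`|x−w|₁, |y−z|₁ ≤ R ⟹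
  |A x y − A w y − A x z + A w z| ≤ β″·R²·e^{2θR}·e^{−θ|w−z|₁}` from the mixed unit second differences).
* §3 `Loc` summability bricks; §4 THE THREE COMPOSED ENVELOPES over an ABSTRACT oscillation bound `G`: **`abs_comp_le_osc_mul_colMass`** (column-charge-free banded right factor:
  `|(A∘Vc)(x,z)_{ab}| ≤ G·Σ'_y Σ_f |Vc(y,z)_{fb}|`), **`abs_comp_le_rowMass_mul_osc`** (row-charge-free banded left factor: `|(Vr∘B)(y,w)_{fg}| ≤ (Σ'_z Σ_b |Vr(y,z)_{fb}|)·G`),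
  **`comp_rowFree_apply_sub`** + **`abs_comp_comp_le_rowMass_mul_oscMixed_mul_colMass`** (the sandwich: `|((Wr∘A)∘Vc)(w,z)_{gb}| ≤ (row mass)·G·(column mass)` with
  `G` a bound on the MIXED second oscillation of `A` over the two bands).
* §5 THE SAME WITH THE LEG LETTERS PLUGGED (§2 into §4): **`abs_comp_le_of_colFree_unitDiff`**, **`abs_comp_le_of_rowFree_unitDiff`**, **`abs_comp_comp_le_of_unitDiffMixed`**.
Unit `b2b-balaban-beta-d1-formalise-leaf-01` (gen 30), D1 swarm LEAF PROVER 01, road «BF-x»; INTENT-1 [D1LEAF01-G30-INTENT-1].  Not in print; our bookkeeping.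
-/

noncomputable section

open scoped BigOperators

namespace Summit.QuantumFields.BalabanUV.Beta.D1BFx.ChargeFreeEnvelopes

open Literature.MathematicalPhysics.QuantumFieldTheory.Balaban1983to89
open Literature.MathematicalPhysics.QuantumFieldTheory.Balaban1983to89.Beta
open B12Sec2to5 (l1 l1_nonneg)
open ExpKernelCalculus (Site MKer comp l1_sub_triangle l1_sub_symm)
open AffineAveraging (unitVec)
open Summit.QuantumFields.BalabanUV.Beta.TameKernelCalculus (Tame Spr Loc slice_tame slices_tame)
open Summit.QuantumFields.BalabanUV.Beta.D1BFx.ChargeFreeComposition (comp_eq_tsum_mul_sub abs_comp_le_tsum_abs_mul_abs_sub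
  abs_comp_le_mul_tsum_of_support)

variable {D : ℕ} {F : Type*} [Fintype F]

/-! ## §1 Telescoping inside an `ℓ¹`-ball -/

omit [Fintype F] in
/-- [folklore] The `ℓ¹`-norm of a lattice vector is the (real cast of the) sum of the absolute values of its integer coordinates. -/
theorem natAbs_sum_eq_l1 (v : Site D) : (((∑ i, (v i).natAbs : ℕ)) : ℝ) = l1 v := by
  unfold B12Sec2to5.l1
  push_cast
  refine Finset.sum_congr rfl fun i _ => ?_
  rw [Nat.cast_natAbs, Int.cast_abs]

omit [Fintype F] in
/-- [folklore] **ONE STEP TOWARDS THE CENTRE**: a lattice point at coordinate-`ℓ¹`-distance `k + 1` from `c` is one unit step (in some axis, in some orientation) away from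
a lattice point at distance `k`. -/
theorem exists_unit_step {c y : Site D} {k : ℕ} (hk : ∑ i, (y i - c i).natAbs = k + 1) :
    ∃ (i : Fin D) (y' : Site D), ∑ j, (y' j - c j).natAbs = k ∧ (y = y' + unitVec i ∨ y' = y + unitVec i) := by
  classical
  have hne : ∃ i, (y i - c i).natAbs ≠ 0 := by
    by_contra h
    push Not at h
    have h0 : ∑ i, (y i - c i).natAbs = 0 := Finset.sum_eq_zero fun i _ => h i
    omega
  obtain ⟨i, hi⟩ := hne
  have hsplit : ∀ v : Site D, ∑ j, (v j - c j).natAbs = (v i - c i).natAbs + ∑ j ∈ Finset.univ.erase i, (v j - c j).natAbs :=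
    fun v => (Finset.add_sum_erase Finset.univ (fun j => (v j - c j).natAbs) (Finset.mem_univ i)).symm
  have hui : unitVec (d := D) i i = 1 := by simp [AffineAveraging.unitVec]
  have huj : ∀ j, j ≠ i → unitVec (d := D) i j = 0 := fun j hj => by simp [AffineAveraging.unitVec, Pi.single_eq_of_ne hj]
  rcases lt_or_gt_of_ne (fun h : y i - c i = 0 => hi (by rw [h]; rfl)) with hneg | hpos
  · -- `y i < c i`: step up
    refine ⟨i, y + unitVec i, ?_, Or.inr rfl⟩
    have e1 : ((y + unitVec i) i - c i).natAbs + 1 = (y i - c i).natAbs := by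
      rw [Pi.add_apply, hui]; omega
    have e2 : ∑ j ∈ Finset.univ.erase i, ((y + unitVec i) j - c j).natAbs = ∑ j ∈ Finset.univ.erase i, (y j - c j).natAbs :=
      Finset.sum_congr rfl fun j hj => by rw [Pi.add_apply, huj j (Finset.ne_of_mem_erase hj), add_zero]
    have h1 := hsplit (y + unitVec i)
    have h2 := hsplit y
    omega
  · -- `c i < y i`: step down
    refine ⟨i, y - unitVec i, ?_, Or.inl (sub_add_cancel y (unitVec i)).symm⟩
    have e1 : ((y - unitVec i) i - c i).natAbs + 1 = (y i - c i).natAbs := by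
      rw [Pi.sub_apply, hui]; omega
    have e2 : ∑ j ∈ Finset.univ.erase i, ((y - unitVec i) j - c j).natAbs = ∑ j ∈ Finset.univ.erase i, (y j - c j).natAbs :=
      Finset.sum_congr rfl fun j hj => by rw [Pi.sub_apply, huj j (Finset.ne_of_mem_erase hj), sub_zero]
    have h1 := hsplit (y - unitVec i)
    have h2 := hsplit y
    omega

omit [Fintype F] in
/-- [folklore] **TELESCOPING INSIDE AN `ℓ¹`-BALL, counted form**: if every unit difference of `f` between two points of the ball `{w : |w − c|₁ ≤ ρ}` is `≤ G`, then for
every `y` in the ball at coordinate distance `k` from `c`, `|f y − f c| ≤ G·k` (induction on `k` via `exists_unit_step`). -/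
theorem abs_sub_le_mul_of_unitDiff_ball {f : Site D → ℝ} {G ρ : ℝ} (c : Site D)
    (hG : ∀ (κ : Fin D) (w : Site D), l1 (w - c) ≤ ρ → l1 (w + unitVec κ - c) ≤ ρ → |f (w + unitVec κ) - f w| ≤ G) :
    ∀ (k : ℕ) (y : Site D), ∑ i, (y i - c i).natAbs = k → (k : ℝ) ≤ ρ → |f y - f c| ≤ G * k := by
  have hl1 : ∀ v : Site D, l1 (v - c) = (((∑ i, (v i - c i).natAbs : ℕ)) : ℝ) := fun v => by
    rw [natAbs_sum_eq_l1]; rfl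
  intro k
  induction k with
  | zero =>
    intro y hy _
    have hyc : y = c := by
      funext i
      have h := Finset.sum_eq_zero_iff.mp hy i (Finset.mem_univ i)
      omega
    rw [hyc, sub_self, abs_zero, Nat.cast_zero, mul_zero]
  | succ k ih =>
    intro y hy hρ
    obtain ⟨i, y', hy', hstep⟩ := exists_unit_step hy
    have hk : (k : ℝ) ≤ ρ := by push_cast at hρ; linarith
    have h1 : |f y' - f c| ≤ G * k := ih y' hy' hk
    have hly : l1 (y - c) ≤ ρ := by rw [hl1 y, hy]; exact hρ
    have hly' : l1 (y' - c) ≤ ρ := by rw [hl1 y', hy']; exact hk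
    have h2 : |f y - f y'| ≤ G := by
      rcases hstep with e | e
      · have h := hG i y' hly' (by rw [← e]; exact hly)
        rwa [← e] at h
      · have h := hG i y hly (by rw [← e]; exact hly')
        rw [← e] at h
        rwa [abs_sub_comm] at h
    calc |f y - f c| = |(f y - f y') + (f y' - f c)| := by ring_nf
      _ ≤ |f y - f y'| + |f y' - f c| := abs_add_le _ _
      _ ≤ G + G * k := add_le_add h2 h1
      _ = G * ((k + 1 : ℕ) : ℝ) := by push_cast; ring

omit [Fintype F] in
/-- [folklore] **TELESCOPING INSIDE AN `ℓ¹`-BALL**: unit differences `≤ G` between points of the ball `{w : |w − c|₁ ≤ ρ}` ⟹ `|f y − f c| ≤ G·|y − c|₁` for every `y` in the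
ball. -/
theorem abs_sub_le_of_unitDiff_ball {f : Site D → ℝ} {G ρ : ℝ} (c : Site D)
    (hG : ∀ (κ : Fin D) (w : Site D), l1 (w - c) ≤ ρ → l1 (w + unitVec κ - c) ≤ ρ → |f (w + unitVec κ) - f w| ≤ G)
    (y : Site D) (hy : l1 (y - c) ≤ ρ) : |f y - f c| ≤ G * l1 (y - c) := by
  have hl1 : l1 (y - c) = (((∑ i, (y i - c i).natAbs : ℕ)) : ℝ) := by rw [natAbs_sum_eq_l1]; rfl
  have h := abs_sub_le_mul_of_unitDiff_ball c hG (∑ i, (y i - c i).natAbs) y rfl (by rw [← hl1]; exact hy)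
  rwa [← hl1] at h

/-! ## §2 Leg oscillations from unit-difference envelopes with decay -/

omit [Fintype F] in
/-- [folklore] **SECOND-VARIABLE OSCILLATION OF A LEG**: unit differences in the second variable `|A x (w + e_ρ) a b − A x w a b| ≤ β′·e^{−θ|x − w|₁}` (`β′, θ ≥ 0`) ⟹ for
`|y − z|₁ ≤ R`, `|A x y a b − A x z a b| ≤ β′·R·e^{θR}·e^{−θ|x − z|₁}` (the decay survives at the band's centre at the price `e^{θR}`). -/
theorem osc_snd_of_unitDiff {A : MKer D F} {β' θ R : ℝ} (hβ' : 0 ≤ β') (hθ : 0 ≤ θ)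
    (hA : ∀ (ρ : Fin D) (x w : Site D) (a b : F), |A x (w + unitVec ρ) a b - A x w a b| ≤ β' * Real.exp (-θ * l1 (x - w)))
    (x y z : Site D) (a b : F) (hyz : l1 (y - z) ≤ R) :
    |A x y a b - A x z a b| ≤ β' * R * Real.exp (θ * R) * Real.exp (-θ * l1 (x - z)) := by
  set G : ℝ := β' * Real.exp (θ * R) * Real.exp (-θ * l1 (x - z)) with hGdef
  have hG0 : 0 ≤ G := by positivity
  have hball : ∀ (κ : Fin D) (w : Site D), l1 (w - z) ≤ R → l1 (w + unitVec κ - z) ≤ R →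
      |A x (w + unitVec κ) a b - A x w a b| ≤ G := by
    intro κ w hw _
    refine (hA κ x w a b).trans ?_
    rw [hGdef, mul_assoc, ← Real.exp_add]
    refine mul_le_mul_of_nonneg_left (Real.exp_le_exp.mpr ?_) hβ'
    have ht : l1 (x - z) ≤ l1 (x - w) + l1 (w - z) := l1_sub_triangle x w z
    nlinarith
  have h := abs_sub_le_of_unitDiff_ball (f := fun w => A x w a b) z hball y hyz
  calc |A x y a b - A x z a b| ≤ G * l1 (y - z) := h
    _ ≤ G * R := mul_le_mul_of_nonneg_left hyz hG0
    _ = β' * R * Real.exp (θ * R) * Real.exp (-θ * l1 (x - z)) := by rw [hGdef]; ring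

omit [Fintype F] in
/-- [folklore] **FIRST-VARIABLE OSCILLATION OF A LEG**: `|A (w + e_ρ) y a b − A w y a b| ≤ β′·e^{−θ|w − y|₁}` ⟹ for `|x − w|₁ ≤ R`,
`|A x y a b − A w y a b| ≤ β′·R·e^{θR}·e^{−θ|w − y|₁}`. -/
theorem osc_fst_of_unitDiff {A : MKer D F} {β' θ R : ℝ} (hβ' : 0 ≤ β') (hθ : 0 ≤ θ)
    (hA : ∀ (ρ : Fin D) (w y : Site D) (a b : F), |A (w + unitVec ρ) y a b - A w y a b| ≤ β' * Real.exp (-θ * l1 (w - y)))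
    (x w y : Site D) (a b : F) (hxw : l1 (x - w) ≤ R) :
    |A x y a b - A w y a b| ≤ β' * R * Real.exp (θ * R) * Real.exp (-θ * l1 (w - y)) := by
  set G : ℝ := β' * Real.exp (θ * R) * Real.exp (-θ * l1 (w - y)) with hGdef
  have hG0 : 0 ≤ G := by positivity
  have hball : ∀ (κ : Fin D) (v : Site D), l1 (v - w) ≤ R → l1 (v + unitVec κ - w) ≤ R →
      |A (v + unitVec κ) y a b - A v y a b| ≤ G := by
    intro κ v hv _
    refine (hA κ v y a b).trans ?_
    rw [hGdef, mul_assoc, ← Real.exp_add]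
    refine mul_le_mul_of_nonneg_left (Real.exp_le_exp.mpr ?_) hβ'
    have ht : l1 (w - y) ≤ l1 (w - v) + l1 (v - y) := l1_sub_triangle w v y
    rw [l1_sub_symm w v] at ht
    nlinarith
  have h := abs_sub_le_of_unitDiff_ball (f := fun v => A v y a b) w hball x hxw
  calc |A x y a b - A w y a b| ≤ G * l1 (x - w) := h
    _ ≤ G * R := mul_le_mul_of_nonneg_left hxw hG0
    _ = β' * R * Real.exp (θ * R) * Real.exp (-θ * l1 (w - y)) := by rw [hGdef]; ring

omit [Fintype F] in
/-- [folklore] **MIXED SECOND OSCILLATION OF A LEG**: mixed unit second differences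
`|A (w+e_ρ) (y+e_ρ′) − A w (y+e_ρ′) − A (w+e_ρ) y + A w y| ≤ β″·e^{−θ|w − y|₁}` ⟹ for `|x − w|₁ ≤ R` and `|y − z|₁ ≤ R`,
`|A x y − A w y − A x z + A w z| ≤ β″·R²·e^{2θR}·e^{−θ|w − z|₁}` (telescope in `y` the function `A x · − A w ·`, whose unit differences telescope in the first variable). -/
theorem osc_mixed_of_unitDiff {A : MKer D F} {β'' θ R : ℝ} (hβ'' : 0 ≤ β'') (hθ : 0 ≤ θ)
    (hA : ∀ (ρ ρ' : Fin D) (w y : Site D) (a b : F),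
      |A (w + unitVec ρ) (y + unitVec ρ') a b - A w (y + unitVec ρ') a b - A (w + unitVec ρ) y a b + A w y a b| ≤ β'' * Real.exp (-θ * l1 (w - y)))
    (x w y z : Site D) (a b : F) (hxw : l1 (x - w) ≤ R) (hyz : l1 (y - z) ≤ R) :
    |A x y a b - A w y a b - A x z a b + A w z a b| ≤ β'' * R ^ 2 * Real.exp (2 * θ * R) * Real.exp (-θ * l1 (w - z)) := by
  have hR : 0 ≤ R := (l1_nonneg _).trans hxw
  -- the inner constant: mixed unit differences over the two balls
  set G₁ : ℝ := β'' * Real.exp (2 * θ * R) * Real.exp (-θ * l1 (w - z)) with hG₁def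
  have hG₁0 : 0 ≤ G₁ := by positivity
  have hinner : ∀ (ρ' : Fin D) (y₀ : Site D), l1 (y₀ - z) ≤ R →
      |(A x (y₀ + unitVec ρ') a b - A w (y₀ + unitVec ρ') a b) - (A x y₀ a b - A w y₀ a b)| ≤ G₁ * R := by
    intro ρ' y₀ hy₀
    -- telescope `v ↦ A v (y₀ + e) − A v y₀` from `w` to `x`
    have hball : ∀ (κ : Fin D) (v : Site D), l1 (v - w) ≤ R → l1 (v + unitVec κ - w) ≤ R →
        |(A (v + unitVec κ) (y₀ + unitVec ρ') a b - A (v + unitVec κ) y₀ a b) - (A v (y₀ + unitVec ρ') a b - A v y₀ a b)| ≤ G₁ := by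
      intro κ v hv _
      have h := hA κ ρ' v y₀ a b
      have e : A (v + unitVec κ) (y₀ + unitVec ρ') a b - A (v + unitVec κ) y₀ a b - (A v (y₀ + unitVec ρ') a b - A v y₀ a b)
          = A (v + unitVec κ) (y₀ + unitVec ρ') a b - A v (y₀ + unitVec ρ') a b - A (v + unitVec κ) y₀ a b + A v y₀ a b := by ring
      rw [e]
      refine h.trans ?_
      rw [hG₁def, mul_assoc, ← Real.exp_add]
      refine mul_le_mul_of_nonneg_left (Real.exp_le_exp.mpr ?_) hβ''
      have t1 : l1 (w - z) ≤ l1 (w - v) + l1 (v - z) := l1_sub_triangle w v z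
      have t2 : l1 (v - z) ≤ l1 (v - y₀) + l1 (y₀ - z) := l1_sub_triangle v y₀ z
      rw [l1_sub_symm w v] at t1
      nlinarith
    have h := abs_sub_le_of_unitDiff_ball (f := fun v => A v (y₀ + unitVec ρ') a b - A v y₀ a b) w hball x hxw
    have e : (A x (y₀ + unitVec ρ') a b - A x y₀ a b) - (A w (y₀ + unitVec ρ') a b - A w y₀ a b)
        = (A x (y₀ + unitVec ρ') a b - A w (y₀ + unitVec ρ') a b) - (A x y₀ a b - A w y₀ a b) := by ring
    rw [e] at h
    exact h.trans (mul_le_mul_of_nonneg_left hxw hG₁0)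
  -- telescope `y ↦ A x y − A w y` from `z` to `y`
  have hGR0 : 0 ≤ G₁ * R := mul_nonneg hG₁0 hR
  have hball : ∀ (κ : Fin D) (y₀ : Site D), l1 (y₀ - z) ≤ R → l1 (y₀ + unitVec κ - z) ≤ R →
      |(A x (y₀ + unitVec κ) a b - A w (y₀ + unitVec κ) a b) - (A x y₀ a b - A w y₀ a b)| ≤ G₁ * R :=
    fun κ y₀ hy₀ _ => hinner κ y₀ hy₀
  have h := abs_sub_le_of_unitDiff_ball (f := fun y₀ => A x y₀ a b - A w y₀ a b) z hball y hyz
  have e : (A x y a b - A w y a b) - (A x z a b - A w z a b) = A x y a b - A w y a b - A x z a b + A w z a b := by ring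
  rw [e] at h
  calc |A x y a b - A w y a b - A x z a b + A w z a b| ≤ G₁ * R * l1 (y - z) := h
    _ ≤ G₁ * R * R := mul_le_mul_of_nonneg_left hyz hGR0
    _ = β'' * R ^ 2 * Real.exp (2 * θ * R) * Real.exp (-θ * l1 (w - z)) := by rw [hG₁def]; ring

/-! ## §3 Summability bricks -/

omit [Fintype F] in
/-- [folklore] Columns of a localised kernel are absolutely summable. -/
theorem Loc.summable_col_abs {V : MKer D F} (hV : Loc V) (z : Site D) (f b : F) : Summable fun y : Site D => |V y z f b| := by
  obtain ⟨ψ, hψ, hψ0, hle⟩ := hV.tame.2.1 z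
  exact Summable.of_nonneg_of_le (fun y => abs_nonneg _) (fun y => hle y f b) hψ

omit [Fintype F] in
/-- [folklore] Columns of a localised kernel are summable. -/
theorem Loc.summable_col {V : MKer D F} (hV : Loc V) (z : Site D) (f b : F) : Summable fun y : Site D => V y z f b :=
  (Loc.summable_col_abs hV z f b).of_abs

omit [Fintype F] in
/-- [folklore] Rows of a localised kernel are absolutely summable. -/
theorem Loc.summable_row_abs {V : MKer D F} (hV : Loc V) (y : Site D) (f b : F) : Summable fun z : Site D => |V y z f b| := by
  obtain ⟨φ, hφ, hφ0, hle⟩ := hV.tame.1 y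
  exact Summable.of_nonneg_of_le (fun z => abs_nonneg _) (fun z => hle z f b) hφ

omit [Fintype F] in
/-- [folklore] Rows of a localised kernel are summable. -/
theorem Loc.summable_row {V : MKer D F} (hV : Loc V) (y : Site D) (f b : F) : Summable fun z : Site D => V y z f b :=
  (Loc.summable_row_abs hV y f b).of_abs

/-! ## §4 The three composed envelopes over an abstract oscillation bound -/

/-- [folklore] **COLUMN-CHARGE-FREE BANDED RIGHT FACTOR**: `A` tame, `Vc` localised with the column `(·, z, ·, b)` supported in the band `|y − z|₁ ≤ R` and charge-free
in every fibre row `f`; if `|A x y a f − A x z a f| ≤ G` on the band, then `|(A ∘ Vc)(x,z)_{ab}| ≤ G·Σ'_y Σ_f |Vc(y,z)_{fb}|` (`ChargeFreeComposition.abs_comp_le_mul_tsum_of_support`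
at the base point `z`). -/
theorem abs_comp_le_osc_mul_colMass {A Vc : MKer D F} (hA : Tame A) (hVc : Loc Vc) {R G : ℝ} {x z : Site D} {a b : F}
    (hVcR : ∀ (y : Site D) (f : F), R < l1 (y - z) → Vc y z f b = 0) (hVc0 : ∀ f : F, ∑' y : Site D, Vc y z f b = 0)
    (hG : ∀ (y : Site D) (f : F), l1 (y - z) ≤ R → |A x y a f - A x z a f| ≤ G) :
    |comp A Vc x z a b| ≤ G * ∑' y : Site D, ∑ f, |Vc y z f b| :=
  abs_comp_le_mul_tsum_of_support x z z a b hVc0 (fun f => Loc.summable_col hVc z f b) (fun f => slice_tame hA hVc.tame x z a f b)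
    fun y f hne => hG y f (le_of_not_gt fun h => hne (hVcR y f h))

/-- [folklore] **ROW-CHARGE-FREE BANDED LEFT FACTOR**: `Vr` localised with the row `(y, ·, f, ·)` supported in the band `|z − y|₁ ≤ R` and charge-free in every fibre
column `b`, `B` tame; if `|B z w b g − B y w b g| ≤ G` on the band, then `|(Vr ∘ B)(y,w)_{fg}| ≤ (Σ'_z Σ_b |Vr(y,z)_{fb}|)·G`. -/
theorem abs_comp_le_rowMass_mul_osc {Vr B : MKer D F} (hVr : Loc Vr) (hB : Tame B) {R G : ℝ} {y w : Site D} {f g : F}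
    (hVrR : ∀ (z : Site D) (b : F), R < l1 (z - y) → Vr y z f b = 0) (hVr0 : ∀ b : F, ∑' z : Site D, Vr y z f b = 0)
    (hG : ∀ (z : Site D) (b : F), l1 (z - y) ≤ R → |B z w b g - B y w b g| ≤ G) :
    |comp Vr B y w f g| ≤ (∑' z : Site D, ∑ b, |Vr y z f b|) * G := by
  have hAs : ∀ b : F, Summable fun z : Site D => Vr y z f b := fun b => Loc.summable_row hVr y f b
  have hAK : ∀ b : F, Summable fun z : Site D => Vr y z f b * B z w b g := fun b => slice_tame hVr.tame hB y w f b g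
  have habs : Summable fun z : Site D => ∑ b, |Vr y z f b| := summable_sum fun b _ => Loc.summable_row_abs hVr y f b
  have hpt : ∀ z : Site D, ∑ b, |Vr y z f b| * |B z w b g - B y w b g| ≤ ∑ b, |Vr y z f b| * G := fun z =>
    Finset.sum_le_sum fun b _ => by
      by_cases h0 : Vr y z f b = 0
      · rw [h0, abs_zero, zero_mul, zero_mul]
      · exact mul_le_mul_of_nonneg_left (hG z b (le_of_not_gt fun h => h0 (hVrR z b h))) (abs_nonneg _)
  have hmaj : Summable fun z : Site D => ∑ b, |Vr y z f b| * G := by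
    simpa only [← Finset.sum_mul] using habs.mul_right G
  have hS : Summable fun z : Site D => ∑ b, |Vr y z f b| * |B z w b g - B y w b g| :=
    Summable.of_nonneg_of_le (fun z => Finset.sum_nonneg fun b _ => mul_nonneg (abs_nonneg _) (abs_nonneg _)) hpt hmaj
  refine (abs_comp_le_tsum_abs_mul_abs_sub y w f g hVr0 hAs hAK hS).trans ?_
  refine (Summable.tsum_le_tsum hpt hS hmaj).trans (le_of_eq ?_)
  rw [← tsum_mul_right]
  exact tsum_congr fun z => by rw [Finset.sum_mul]

/-- [folklore] **THE ROW-CHARGE-FREE LEFT FACTOR, TWO COLUMNS COMPARED**: for `Wr` localised and row-charge-free at `(w, g)` and `A` tame,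
`(Wr ∘ A)(w,y)_{gf} − (Wr ∘ A)(w,z)_{gf} = Σ'_x Σ_h Wr(w,x)_{gh}·((A(x,y)_{hf} − A(w,y)_{hf}) − (A(x,z)_{hf} − A(w,z)_{hf}))` — the leg's MIXED second difference appears. -/
theorem comp_rowFree_apply_sub {Wr A : MKer D F} (hWr : Loc Wr) (hA : Tame A) {w : Site D} {g : F}
    (hWr0 : ∀ h : F, ∑' x : Site D, Wr w x g h = 0) (y z : Site D) (f : F) :
    comp Wr A w y g f - comp Wr A w z g f
      = ∑' x : Site D, ∑ h, Wr w x g h * ((A x y h f - A w y h f) - (A x z h f - A w z h f)) := by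
  have hAs : ∀ h : F, Summable fun x : Site D => Wr w x g h := fun h => Loc.summable_row hWr w g h
  have hy := comp_eq_tsum_mul_sub w y g f hWr0 hAs (fun h => slice_tame hWr.tame hA w y g h f)
  have hz := comp_eq_tsum_mul_sub w z g f hWr0 hAs (fun h => slice_tame hWr.tame hA w z g h f)
  have hsub : ∀ (v : Site D) (h : F), Summable fun x : Site D => Wr w x g h * (A x v h f - A w v h f) := fun v h => by
    have hs := (slice_tame hWr.tame hA w v g h f).sub ((hAs h).mul_right (A w v h f))
    refine hs.congr fun x => ?_
    ring
  have hSy : Summable fun x : Site D => ∑ h, Wr w x g h * (A x y h f - A w y h f) := summable_sum fun h _ => hsub y h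
  have hSz : Summable fun x : Site D => ∑ h, Wr w x g h * (A x z h f - A w z h f) := summable_sum fun h _ => hsub z h
  rw [hy, hz, ← hSy.tsum_sub hSz]
  refine tsum_congr fun x => ?_
  rw [← Finset.sum_sub_distrib]
  exact Finset.sum_congr rfl fun h _ => by ring

/-- [folklore] **THE SANDWICH**: `Wr` localised, row `(w, ·, g, ·)` banded (`|x − w|₁ ≤ R`) and row-charge-free; `A` spread; `Vc` localised, column `(·, z, ·, b)` banded and
column-charge-free; if the MIXED second oscillation of `A` over the two bands is `≤ G`, then
`|((Wr ∘ A) ∘ Vc)(w,z)_{gb}| ≤ (Σ'_x Σ_h |Wr(w,x)_{gh}|)·G·(Σ'_y Σ_f |Vc(y,z)_{fb}|)`. -/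
theorem abs_comp_comp_le_rowMass_mul_oscMixed_mul_colMass {Wr A Vc : MKer D F} (hWr : Loc Wr) (hA : Spr A) (hVc : Loc Vc)
    {R G : ℝ} {w z : Site D} {g b : F}
    (hWrR : ∀ (x : Site D) (h : F), R < l1 (x - w) → Wr w x g h = 0) (hWr0 : ∀ h : F, ∑' x : Site D, Wr w x g h = 0)
    (hVcR : ∀ (y : Site D) (f : F), R < l1 (y - z) → Vc y z f b = 0) (hVc0 : ∀ f : F, ∑' y : Site D, Vc y z f b = 0)
    (hG : ∀ (x y : Site D) (h f : F), l1 (x - w) ≤ R → l1 (y - z) ≤ R → |A x y h f - A w y h f - A x z h f + A w z h f| ≤ G) :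
    |comp (comp Wr A) Vc w z g b| ≤ (∑' x : Site D, ∑ h, |Wr w x g h|) * G * ∑' y : Site D, ∑ f, |Vc y z f b| := by
  have hK : Loc (comp Wr A) := hWr.comp_spr hA
  have hrow : Summable fun x : Site D => ∑ h, |Wr w x g h| := summable_sum fun h _ => Loc.summable_row_abs hWr w g h
  have hrow0 : 0 ≤ ∑' x : Site D, ∑ h, |Wr w x g h| := tsum_nonneg fun x => Finset.sum_nonneg fun h _ => abs_nonneg _
  -- the oscillation of `Wr ∘ A` over the right band
  have hosc : ∀ (y : Site D) (f : F), l1 (y - z) ≤ R →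
      |comp Wr A w y g f - comp Wr A w z g f| ≤ (∑' x : Site D, ∑ h, |Wr w x g h|) * G := by
    intro y f hyz
    rw [comp_rowFree_apply_sub hWr hA.tame hWr0 y z f]
    set φ : Site D → ℝ := fun x => ∑ h, Wr w x g h * ((A x y h f - A w y h f) - (A x z h f - A w z h f)) with hφ
    have hpt : ∀ x : Site D, |φ x| ≤ ∑ h, |Wr w x g h| * G := fun x => by
      refine (Finset.abs_sum_le_sum_abs _ _).trans (Finset.sum_le_sum fun h _ => ?_)
      rw [abs_mul]
      by_cases h0 : Wr w x g h = 0
      · rw [h0, abs_zero, zero_mul, zero_mul]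
      · refine mul_le_mul_of_nonneg_left ?_ (abs_nonneg _)
        have e : A x y h f - A w y h f - (A x z h f - A w z h f) = A x y h f - A w y h f - A x z h f + A w z h f := by ring
        rw [e]
        exact hG x y h f (le_of_not_gt fun hh => h0 (hWrR x h hh)) hyz
    have hmaj : Summable fun x : Site D => ∑ h, |Wr w x g h| * G := by
      simpa only [← Finset.sum_mul] using hrow.mul_right G
    have hn : Summable fun x : Site D => ‖φ x‖ := by
      simpa only [Real.norm_eq_abs] using Summable.of_nonneg_of_le (fun x => abs_nonneg (φ x)) hpt hmaj
    have h1 : ‖∑' x, φ x‖ ≤ ∑' x, ‖φ x‖ := norm_tsum_le_tsum_norm hn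
    simp only [Real.norm_eq_abs] at h1 hn
    refine h1.trans ((Summable.tsum_le_tsum hpt hn hmaj).trans (le_of_eq ?_))
    rw [← tsum_mul_right]
    exact tsum_congr fun x => by rw [Finset.sum_mul]
  have h := abs_comp_le_osc_mul_colMass (A := comp Wr A) hK.tame hVc hVcR hVc0 hosc
  simpa only [mul_assoc] using h

/-! ## §5 The composed envelopes with the leg letters plugged -/

/-- [folklore] **COLUMN-CHARGE-FREE PIECE AFTER A LEG WITH SECOND-VARIABLE UNIT DIFFERENCES `≤ β′e^{−θ|·|₁}`**:
`|(A ∘ Vc)(x,z)_{ab}| ≤ (β′·R·e^{θR})·e^{−θ|x − z|₁}·Σ'_y Σ_f |Vc(y,z)_{fb}|`. -/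
theorem abs_comp_le_of_colFree_unitDiff {A Vc : MKer D F} (hA : Tame A) (hVc : Loc Vc) {β' θ R : ℝ} (hβ' : 0 ≤ β') (hθ : 0 ≤ θ)
    (hA₂ : ∀ (ρ : Fin D) (x w : Site D) (a b : F), |A x (w + unitVec ρ) a b - A x w a b| ≤ β' * Real.exp (-θ * l1 (x - w)))
    {z : Site D} {b : F} (hVcR : ∀ (y : Site D) (f : F), R < l1 (y - z) → Vc y z f b = 0) (hVc0 : ∀ f : F, ∑' y : Site D, Vc y z f b = 0)
    (x : Site D) (a : F) :
    |comp A Vc x z a b| ≤ β' * R * Real.exp (θ * R) * Real.exp (-θ * l1 (x - z)) * ∑' y : Site D, ∑ f, |Vc y z f b| :=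
  abs_comp_le_osc_mul_colMass hA hVc hVcR hVc0 fun y f hyz => osc_snd_of_unitDiff hβ' hθ hA₂ x y z a f hyz

/-- [folklore] **ROW-CHARGE-FREE PIECE BEFORE A LEG WITH FIRST-VARIABLE UNIT DIFFERENCES `≤ β′e^{−θ|·|₁}`**:
`|(Vr ∘ B)(y,w)_{fg}| ≤ (Σ'_z Σ_b |Vr(y,z)_{fb}|)·(β′·R·e^{θR})·e^{−θ|y − w|₁}`. -/
theorem abs_comp_le_of_rowFree_unitDiff {Vr B : MKer D F} (hVr : Loc Vr) (hB : Tame B) {β' θ R : ℝ} (hβ' : 0 ≤ β') (hθ : 0 ≤ θ)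
    (hB₁ : ∀ (ρ : Fin D) (w y : Site D) (a b : F), |B (w + unitVec ρ) y a b - B w y a b| ≤ β' * Real.exp (-θ * l1 (w - y)))
    {y : Site D} {f : F} (hVrR : ∀ (z : Site D) (b : F), R < l1 (z - y) → Vr y z f b = 0) (hVr0 : ∀ b : F, ∑' z : Site D, Vr y z f b = 0)
    (w : Site D) (g : F) :
    |comp Vr B y w f g| ≤ (∑' z : Site D, ∑ b, |Vr y z f b|) * (β' * R * Real.exp (θ * R) * Real.exp (-θ * l1 (y - w))) :=
  abs_comp_le_rowMass_mul_osc hVr hB hVrR hVr0 fun z b hzy => osc_fst_of_unitDiff hβ' hθ hB₁ z y w b g hzy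

/-- [folklore] **THE SANDWICH WITH THE MIXED LETTER `≤ β″e^{−θ|·|₁}` PLUGGED**:
`|((Wr ∘ A) ∘ Vc)(w,z)_{gb}| ≤ (Σ'_x Σ_h |Wr(w,x)_{gh}|)·(β″·R²·e^{2θR}·e^{−θ|w − z|₁})·(Σ'_y Σ_f |Vc(y,z)_{fb}|)`. -/
theorem abs_comp_comp_le_of_unitDiffMixed {Wr A Vc : MKer D F} (hWr : Loc Wr) (hA : Spr A) (hVc : Loc Vc) {β'' θ R : ℝ} (hβ'' : 0 ≤ β'') (hθ : 0 ≤ θ)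
    (hA₁₂ : ∀ (ρ ρ' : Fin D) (w y : Site D) (a b : F),
      |A (w + unitVec ρ) (y + unitVec ρ') a b - A w (y + unitVec ρ') a b - A (w + unitVec ρ) y a b + A w y a b| ≤ β'' * Real.exp (-θ * l1 (w - y)))
    {w z : Site D} {g b : F}
    (hWrR : ∀ (x : Site D) (h : F), R < l1 (x - w) → Wr w x g h = 0) (hWr0 : ∀ h : F, ∑' x : Site D, Wr w x g h = 0)
    (hVcR : ∀ (y : Site D) (f : F), R < l1 (y - z) → Vc y z f b = 0) (hVc0 : ∀ f : F, ∑' y : Site D, Vc y z f b = 0) :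
    |comp (comp Wr A) Vc w z g b|
      ≤ (∑' x : Site D, ∑ h, |Wr w x g h|) * (β'' * R ^ 2 * Real.exp (2 * θ * R) * Real.exp (-θ * l1 (w - z))) * ∑' y : Site D, ∑ f, |Vc y z f b| :=
  abs_comp_comp_le_rowMass_mul_oscMixed_mul_colMass hWr hA hVc hWrR hWr0 hVcR hVc0
    fun x y h f hxw hyz => osc_mixed_of_unitDiff hβ'' hθ hA₁₂ x w y z h f hxw hyz

end Summit.QuantumFields.BalabanUV.Beta.D1BFx.ChargeFreeEnvelopes

end
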